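import Literature.Analysis.InnerProduct.FiniteRankDowndate
import Summits.RiemannHypothesis.RiemannHypothesis.Theorems.PfPersistenceIntruderShadow
import HarnessLib

/-!
# PF-persistence THEORY 3, reading (R-d) completed — the MULTI-DRIVER LAW: negative index of a
# window = number of capacitance eigenvalues above one; every intruder is a combination of
# resolvent-filtered off-line profiles (publication cell `pub-rhpf`, theory seat 3, gen 4)

Framing (page 1 of every `pub-rhpf` file): **mechanism/rigidity campaign — nothing here is a claim
about RH.**  Everything in this file is PROVED abstract linear algebra or a DEFINITION; no statement
about `ζ` or about any control family is made; every empirical sentence in the docstrings is labelled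
DATA and refers to `run/shared/lean/pub/pub-rhpf/pub-rhpf-theory-3/THEORY-INTRUDER.md` §10.

Setting (ONE window, continuing `PfPersistenceIntruderShadow`, which is the case of ONE driver):
`E` a real inner product space (the even cosine sector of the windowed form at cutoff `λ = e^a`,
truncation `N`), `T : E →ₗ[ℝ] E` the form's Galerkin operator.  An `OffLineSplitN T ι` records a
decomposition `T = B − ∑ᵢ |vᵢ⟩⟨vᵢ|` over finitely many DRIVERS `v : ι → E` with `B` symmetric and
form-nonnegative.  WHERE IT COMES FROM (PROVED-elementary, explicit formula; DATA for which families
and windows it applies to): for a family whose completed L-function has off-line zero quadruples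
`½ ± δⱼ ± iγⱼ` (`j ∈ ι`, e.g. all those below the height the truncation resolves), the windowed Weil
form on the even sector is `B − 4 ∑ⱼ |dⱼ⟩⟨dⱼ|`, `dⱼ = Im ∫ ξ e^{(δⱼ+iγⱼ)x}`, with `B` = (archimedean +
prime + on-line part + the remaining off-line quadruples) `+ 4 ∑ⱼ |rⱼ⟩⟨rⱼ|`; take `vⱼ = 2 dⱼ`.  Whether
`B ≥ 0` at a given window for a given driver set is DATA (arb PD-certificates per window,
THEORY-INTRUDER §10: Davenport–Heilbronn and Epstein `x² + 5y²` tables).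

* `OffLineSplitN T ι`              — the structure (`B`, `v`, `T = B − ∑ |vᵢ⟩⟨vᵢ|`, `B` symmetric, `B ≥ 0`).
* `negSubspace_finrank_le`         — NEGATIVE INDEX ≤ NUMBER OF DRIVERS: every subspace on which the
  window form is negative definite has dimension `≤ #ι`; `card_orthogonal_intruders_le`: at most `#ι`
  pairwise-orthogonal intruders (tree lemma `finiteRank_downdate_negSubspace_finrank_le`).
* `negSubspace_iff_capacitance`    — MULTI-DRIVER SECULAR LAW (Haynsworth inertia transfer, tree lemma
  `finiteRank_downdate_negSubspace_iff`): with witnesses `B zᵢ = vᵢ`, for every `k` the window form is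
  negative definite on a `k`-dimensional subspace iff the CAPACITANCE form
  `Cap(c) = ∑ cᵢ² − ∑ᵢ∑ⱼ cᵢ cⱼ ⟪vᵢ, zⱼ⟫` (matrix `I − Vᵀ B⁻¹ V`; with `vⱼ = 2dⱼ`: `I − 4 Dᵀ B⁻¹ D`) is;
  i.e. `n₋(window) = #{eigenvalues of 4 Dᵀ B⁻¹ D above 1}` — an exact, finite-`N` count of the
  negative directions by an `m × m` matrix built from the off-line zeros alone.  For one driver this is
  gen 3's `negative_iff_secular_gt_one` (`s(a) = 4 dᵀ A⁻¹ d > 1`).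
* `intruder_eq_sum_resolvent`      — MULTI-DRIVER RESOLVENT SHADOW: with `yᵢ = (B + |ε|)⁻¹ vᵢ` every
  intruder is `∑ᵢ ⟪vᵢ, u⟫ • yᵢ` (tree lemma `finiteRank_downdate_eigenvector_eq_sum`).
* `secular_system`                 — the MATRIX SECULAR EQUATION: the moment vector `cᵢ = ⟪vᵢ, u⟫` is a
  nonzero fixed vector of `M(|ε|) = Vᵀ (B + |ε|)⁻¹ V` (so `1 ∈ spec M(|ε|)` fixes `|ε|`).
* `sum_sq_inner_rung_le`           — GRADED ORTHOGONALITY, jointly: for every unit eigenvector `B φ = α φ`,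
  `∑ᵢ ⟪vᵢ, φ⟫² ≤ α + |ε₁|` (`ε₁` = bottom of the window form).

Don't-look sentence (RULING A24 k4): every statement here holds for ANY symmetric window admitting a
split with `B ≥ 0` — Davenport–Heilbronn, Epstein, planted controls alike; the family-dependent inputs
are the DATA "`B(a,N) ≥ 0` for the driver set `ι`" and the capacitance matrix; nothing in this file
separates ζ (which has no intruder on any served window, and for which `ι = ∅` would be the RH-shaped
statement the cell does not make) from a control.

## References
* E. V. Haynsworth, Linear Algebra Appl. 1 (1968) 73–81. [Haynsworth1968]
* D. S. Bernstein, *Matrix Mathematics* (2009), Fact 6.5.5. [Bernstein2009]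
* P. Arbenz, G. H. Golub, SIAM J. Matrix Anal. Appl. 9 (1988) 40–58. [ArbenzGolub1988]
* G. H. Golub, C. F. Van Loan, *Matrix Computations*, 4th ed. (2013), Thm 8.1.8, §8.4.3. [GolubVanLoan2013]
-/

noncomputable section

open scoped InnerProductSpace BigOperators

set_option linter.dupNamespace false

namespace Summit.RiemannHypothesis.RiemannHypothesis.Theorems.PfPersistenceIntruderShadowMulti

open Literature.Analysis.InnerProduct
open Summit.RiemannHypothesis.RiemannHypothesis.Theorems.PfPersistenceIntruderOrthogonality (Intruder)

variable {E : Type*} [NormedAddCommGroup E] [InnerProductSpace ℝ E]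
variable {ι : Type*} [Fintype ι]

/-- A *split* of the window operator `T` off finitely many drivers: `T = B − ∑ᵢ |vᵢ⟩⟨vᵢ|` with `B`
symmetric and form-nonnegative (the rest of the explicit formula plus the `Re`-profile parts of the
listed off-line quadruples; `vᵢ = 2 · Im`-profile). Existence of a split with `B ≥ 0` at a given window
for a given driver set is DATA. [folklore] -/
structure OffLineSplitN (T : E →ₗ[ℝ] E) (ι : Type*) [Fintype ι] where
  /-- the nonnegative remainder -/
  B : E →ₗ[ℝ] E
  /-- the drivers (`2 ×` the imaginary-part profiles of the listed off-line zeros) -/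
  v : ι → E
  apply_eq : ∀ x : E, T x = B x - ∑ i, ⟪v i, x⟫_ℝ • v i
  B_symm : ∀ x y : E, ⟪B x, y⟫_ℝ = ⟪x, B y⟫_ℝ
  B_nonneg : ∀ x : E, 0 ≤ ⟪B x, x⟫_ℝ

namespace OffLineSplitN

variable {T : E →ₗ[ℝ] E} (S : OffLineSplitN T ι)

/-- The form of `T` in split coordinates: `⟪T x, x⟫ = ⟪B x, x⟫ − ∑ᵢ ⟪vᵢ, x⟫²`. [folklore] -/
theorem inner_apply_self (x : E) : ⟪T x, x⟫_ℝ = ⟪S.B x, x⟫_ℝ - ∑ i, ⟪S.v i, x⟫_ℝ ^ 2 := by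
  rw [S.apply_eq, inner_sub_left, sum_inner]
  congr 1
  exact Finset.sum_congr rfl fun i _ => by rw [real_inner_smul_left, sq]

/-- The eigen-equation of an intruder in split coordinates: `B u − ∑ᵢ ⟪vᵢ, u⟫ vᵢ = −(|ε| u)`.
[folklore] -/
theorem intruder_eq (I : Intruder T) :
    S.B I.vec - ∑ i, ⟪S.v i, I.vec⟫_ℝ • S.v i = -((-I.eig) • I.vec) := by
  rw [← S.apply_eq, I.apply_eq, neg_smul, neg_neg]

/-- **Negative index ≤ number of drivers.** Under a split `T = B − ∑ᵢ |vᵢ⟩⟨vᵢ|` with `B ≥ 0`, every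
subspace on which the window form is negative definite has dimension at most `#ι`.
[cite: GolubVanLoan2013, Thm 8.1.8; Haynsworth1968, inertia additivity formula] -/
theorem negSubspace_finrank_le (S : OffLineSplitN T ι) (W : Submodule ℝ E)
    (hW : ∀ x ∈ W, x ≠ 0 → ⟪T x, x⟫_ℝ < 0) : Module.finrank ℝ W ≤ Fintype.card ι :=
  finiteRank_downdate_negSubspace_finrank_le S.B S.B_nonneg S.v W
    (fun x hx h0 => by rw [← S.inner_apply_self]; exact hW x hx h0)

/-- In the language of intruders: a family of pairwise-orthogonal intruders (unit eigenvectors with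
negative eigenvalues) of a split window has at most `#ι` members — with one driver this is gen 3's
`OffLineSplit.no_two_orthogonal_intruders`. [cite: GolubVanLoan2013, Thm 8.1.8] -/
theorem card_orthogonal_intruders_le (S : OffLineSplitN T ι) {κ : Type*} [Fintype κ] (I : κ → Intruder T)
    (horth : ∀ a b, a ≠ b → ⟪(I a).vec, (I b).vec⟫_ℝ = 0) :
    Fintype.card κ ≤ Fintype.card ι := by
  classical
  let u : κ → E := fun a => (I a).vec
  have hon : Orthonormal ℝ u := ⟨fun a => (I a).norm_eq, fun a b hab => horth a b hab⟩
  have hW := S.negSubspace_finrank_le (Submodule.span ℝ (Set.range u)) ?_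
  · rwa [finrank_span_eq_card hon.linearIndependent] at hW
  intro x hx hx0
  obtain ⟨c, rfl⟩ := Submodule.mem_span_range_iff_exists_fun ℝ |>.mp hx
  have hTx : T (∑ a, c a • u a) = ∑ a, (c a * (I a).eig) • u a := by
    rw [map_sum]
    exact Finset.sum_congr rfl fun a _ => by rw [map_smul, (I a).apply_eq, smul_smul]
  have hform : ⟪T (∑ a, c a • u a), ∑ a, c a • u a⟫_ℝ = ∑ a, c a ^ 2 * (I a).eig := by
    rw [hTx, sum_inner]
    refine Finset.sum_congr rfl fun a _ => ?_
    rw [real_inner_smul_left, hon.inner_right_sum c (Finset.mem_univ a)]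
    ring
  rw [hform]
  have hc : ∃ a, c a ≠ 0 := by
    by_contra h
    push Not at h
    exact hx0 (Finset.sum_eq_zero fun a _ => by rw [h a, zero_smul])
  obtain ⟨a₀, ha₀⟩ := hc
  have hneg : 0 < ∑ a, -(c a ^ 2 * (I a).eig) := by
    apply Finset.sum_pos'
    · intro a _
      have := (I a).eig_neg
      nlinarith [sq_nonneg (c a)]
    · refine ⟨a₀, Finset.mem_univ _, ?_⟩
      have h1 : 0 < c a₀ ^ 2 := by positivity
      nlinarith [(I a₀).eig_neg]
  have : ∑ a, -(c a ^ 2 * (I a).eig) = -∑ a, c a ^ 2 * (I a).eig := Finset.sum_neg_distrib ..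
  linarith

/-- **Multi-driver secular law (inertia transfer).** Given witnesses `B zᵢ = vᵢ` of `B⁻¹ vᵢ`, for every
`k` the window form is negative definite on some `k`-dimensional subspace iff the capacitance form
`c ↦ ∑ cᵢ² − ∑ᵢ∑ⱼ cᵢ cⱼ ⟪vᵢ, zⱼ⟫` (matrix `I − Vᵀ B⁻¹ V`) is negative definite on some `k`-dimensional
subspace of coefficient space: `n₋(window) = #{eigenvalues of Vᵀ B⁻¹ V above 1}`.
[cite: Bernstein2009, Fact 6.5.5; Haynsworth1968, inertia additivity formula; ArbenzGolub1988, capacitance matrix] -/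
theorem negSubspace_iff_capacitance (z : ι → E) (hz : ∀ i, S.B (z i) = S.v i) (k : ℕ) :
    (∃ W : Submodule ℝ E, Module.finrank ℝ W = k ∧ ∀ x ∈ W, x ≠ 0 → ⟪T x, x⟫_ℝ < 0) ↔
    (∃ U : Submodule ℝ (ι → ℝ), Module.finrank ℝ U = k ∧
        ∀ c ∈ U, c ≠ 0 → (∑ i, c i ^ 2 - ∑ i, ∑ j, c i * c j * ⟪S.v i, z j⟫_ℝ) < 0) := by
  have h := finiteRank_downdate_negSubspace_iff S.B S.B_symm S.B_nonneg S.v z hz k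
  simp only [← S.inner_apply_self] at h
  exact h

/-- The window is indefinite iff the capacitance form takes a negative value (the case `k = 1`,
unpacked): `∃ x, ⟪T x, x⟫ < 0 ↔ ∃ c, ∑ cᵢ² < ∑ᵢ∑ⱼ cᵢ cⱼ ⟪vᵢ, zⱼ⟫`, i.e. `λ_max(Vᵀ B⁻¹ V) > 1`.
[cite: Bernstein2009, Fact 6.5.5; ArbenzGolub1988, capacitance matrix] -/
theorem negative_iff_capacitance_negative (z : ι → E) (hz : ∀ i, S.B (z i) = S.v i) :
    (∃ x : E, ⟪T x, x⟫_ℝ < 0) ↔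
    ∃ c : ι → ℝ, (∑ i, c i ^ 2 - ∑ i, ∑ j, c i * c j * ⟪S.v i, z j⟫_ℝ) < 0 := by
  constructor
  · rintro ⟨x, hx⟩
    refine ⟨fun i => ⟪S.v i, x⟫_ℝ, lt_of_le_of_lt ?_ (show ⟪S.B x, x⟫_ℝ - ∑ i, ⟪S.v i, x⟫_ℝ ^ 2 < 0 by
      rw [← S.inner_apply_self]; exact hx)⟩
    exact finiteRank_downdate_capacitance_le S.B S.B_symm S.B_nonneg S.v z hz x
  · rintro ⟨c, hc⟩
    refine ⟨∑ j, c j • z j, ?_⟩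
    rw [S.inner_apply_self]
    exact lt_of_le_of_lt (finiteRank_downdate_le_capacitance S.B S.v z hz c) hc

/-- **Multi-driver resolvent shadow.** If `yᵢ` solves `B yᵢ + |ε| yᵢ = vᵢ` then the intruder is
`∑ᵢ ⟪vᵢ, u⟫ • yᵢ`: it lies in the span of the drivers filtered through the resolvent of the rest of the
form. [cite: GolubVanLoan2013, Thm 8.4.3 (c); ArbenzGolub1988, block secular equation] -/
theorem intruder_eq_sum_resolvent (I : Intruder T) (y : ι → E)
    (hy : ∀ i, S.B (y i) + (-I.eig) • y i = S.v i) :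
    I.vec = ∑ i, ⟪S.v i, I.vec⟫_ℝ • y i :=
  finiteRank_downdate_eigenvector_eq_sum S.B S.B_nonneg S.v y (neg_pos.mpr I.eig_neg)
    (S.intruder_eq I) hy

/-- **Matrix secular equation** at the intruder eigenvalue: the moment vector `cᵢ = ⟪vᵢ, u⟫` is nonzero
and fixed by `M(|ε|)ᵢⱼ = ⟪vᵢ, yⱼ⟫ = (Vᵀ (B + |ε|)⁻¹ V)ᵢⱼ`; `1` is an eigenvalue of `M(|ε|)`.
[cite: GolubVanLoan2013, Thm 8.4.3 (a); ArbenzGolub1988, block secular equation] -/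
theorem secular_system (I : Intruder T) (y : ι → E)
    (hy : ∀ i, S.B (y i) + (-I.eig) • y i = S.v i) :
    (fun i => ⟪S.v i, I.vec⟫_ℝ) ≠ 0 ∧
      ∀ i, ⟪S.v i, I.vec⟫_ℝ = ∑ j, ⟪S.v i, y j⟫_ℝ * ⟪S.v j, I.vec⟫_ℝ :=
  finiteRank_downdate_secular_system S.B S.B_nonneg S.v y (neg_pos.mpr I.eig_neg)
    (by intro h; have := I.norm_eq; rw [h, norm_zero] at this; exact zero_ne_one this)
    (S.intruder_eq I) hy

/-- **Graded orthogonality of the drivers to the rungs of `B`, jointly.** If `ε₁` bounds the window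
form from below (`ε₁ ⟪x, x⟫ ≤ ⟪T x, x⟫`, e.g. the bottom eigenvalue) then every unit eigenvector
`B φ = α φ` has `∑ᵢ ⟪vᵢ, φ⟫² ≤ α − ε₁`. [folklore] -/
theorem sum_sq_inner_rung_le {ε₁ α : ℝ} {φ : E} (hbot : ∀ x : E, ε₁ * ⟪x, x⟫_ℝ ≤ ⟪T x, x⟫_ℝ)
    (hφ : S.B φ = α • φ) (hφ1 : ‖φ‖ = 1) : ∑ i, ⟪S.v i, φ⟫_ℝ ^ 2 ≤ α + -ε₁ :=
  finiteRank_downdate_sum_sq_inner_le S.B S.v (ε := -ε₁)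
    (fun x => by have h := hbot x; rw [S.inner_apply_self] at h; linarith) hφ hφ1

end OffLineSplitN

end Summit.RiemannHypothesis.RiemannHypothesis.Theorems.PfPersistenceIntruderShadowMulti

end
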